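import Summits.HubbardSuperconductivity.HubbardSuperconductivity.Theses.AposterioriCapRg
import Literature.MathematicalPhysics.QuantumLattice.XYGaugeTwistWitnesses

/-!
# `XYOrderOpennessLargeSpin`: the translation, site-inversion and norm clauses are ALL load-bearing

Negative lemmas for the crux `AposterioriCapRg.XYOrderOpennessLargeSpin`
(stmt-HubbardSuperconductivity-13895; standing disprover `cdisprove`, 2026-08-16). Neither theorem
refutes the crux: each refutes the crux WITH ONE HYPOTHESIS ON THE PERTURBATION CLASS DELETED
(statement otherwise byte-identical, written out inline), at EVERY spin `n/2 ≥ 1/2`, so any proof of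
the crux must use both covariance clauses and the norm clause.

* `xyOrderOpennessLargeSpin_false_without_inversion`: drop `reindexOp (Equiv.neg _) (w x) = w (-x)`;
  witness = star-attributed commensurate helical rule (linear gauge `q_L·x`, the Dzyaloshinskii–Moriya
  mechanism of `Theorems.AposterioriCapRgKlsOrderOpenness_refuted`, now at every spin).
* `xyOrderOpennessLargeSpin_false_without_translation`: drop `∀ v, reindexOp (Equiv.addRight v) (w x)
  = w (x + v)`; witness = star-attributed rule of the EVEN tent gauge `θ_L·dist(x₀, 0)` (a reflected
  spiral: two domain walls of opposite helicity), which IS site-inversion covariant.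
* `xyOrderOpennessLargeSpin_false_without_normBound`: replace `∃ hw : IsHermitian (w x), ∀ i,
  |hw.eigenvalues i| ≤ 1` by `IsHermitian (w x)`; witness = star rule of the STAGGERED gauge
  `π(x₀+x₁)` on even sides (the sublattice rotation: `H + εΣw⋆ = -H`, the antiferromagnet), which is
  translation covariant and even modulo `2π` — the `u = -1` branch of the exhaustion lemma.

In all cases `H + ε₀ Σ_x w⋆_x = R_ψ H R_ψᴴ` exactly, `Σ_x e^{iψ_x} = 0` exactly, and the engine
`XYGaugeTwist.twisted_order_le` with the KLS infrared bound gives the momentum-zero order parameter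
`≤ 8n/(5·2k) → 0` against the claimed `≥ (n/2)²/4`. The complementary tightness statement
`XYGaugeTwist.wStar_eq_zero_of_covariant` (both covariances + the norm clause kill every gauge twist;
each clause removes exactly one of the three witnesses)
is why no member of this family touches the crux itself. All the mathematics is in
`Literature/MathematicalPhysics/QuantumLattice/XYGaugeTwist.lean`; this file only assembles.
-/

noncomputable section

namespace Summit.HubbardSuperconductivity.HubbardSuperconductivity.Theorems.XYOrderOpennessLargeSpin.Negative

open Matrix Complex Finset
open scoped ComplexOrder
open Literature.MathematicalPhysics.QuantumLattice Literature.Probability.LatticeModels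
open Literature.MathematicalPhysics.QuantumLattice.XYGaugeTwist
open Summit.HubbardSuperconductivity.HubbardSuperconductivity.Theses.AposterioriCapRg

/-- **LOAD-BEARING (inversion).** `XYOrderOpennessLargeSpin` with the site-inversion covariance
clause dropped is FALSE at EVERY spin: for any `n₀`, take `n = n₀`, `r = 1`; given `ε₀`, the
star-attributed helical rule `w⋆_x` of the commensurate linear gauge `ψ = q_L·x`,
`θ⋆ = min(ε₀/(2n²), 1/2)`, is admissible (range 1, spectrum in `[-1,1]`, `U(1)`, translation
covariant) and `H + ε₀ Σ_x w⋆_x = R_ψ H R_ψᴴ`; by the engine the `q = 0` order parameter is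
`≤ 8(2k)² · n(2k)/5 / (2k)⁴ = 8n/(5·2k) → 0`. So any proof of the crux must use site inversion.
[folklore] -/
theorem xyOrderOpennessLargeSpin_false_without_inversion :
    ¬ (∃ n₀ : ℕ, 1 ≤ n₀ ∧ ∀ (n r : ℕ), n₀ ≤ n → ∃ ε₀ : ℝ, 0 < ε₀ ∧
    ∀ (W : ∀ L : ℕ, Op (TorusSite 2 L) (n + 1)) (ε : ℝ), |ε| ≤ ε₀ →
      (∀ (L : ℕ) [NeZero L], ∃ w : TorusSite 2 L → Op (TorusSite 2 L) (n + 1),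
        W L = ∑ x, w x ∧ ∀ x, IsSupportedOn (w x) (torusBall x r) ∧
          (∃ hw : Matrix.IsHermitian (w x), ∀ i, |hw.eigenvalues i| ≤ 1) ∧
          Commute (w x) (totalSpin n 2) ∧
          (∀ v, reindexOp (Equiv.addRight v) (w x) = w (x + v))) →
      ∃ k₀ : ℕ, ∀ k : ℕ, k₀ ≤ k → ∀ [NeZero (2 * k)],
        ((n : ℝ) / 2) ^ 2 / 4 ≤ (∑ x : TorusSite 2 (2 * k), ∑ y : TorusSite 2 (2 * k),
          ((xyTorus 2 (2 * k) n + (ε : ℂ) • W (2 * k)).groundStateFunctional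
            (siteSpin n x 0 * siteSpin n y 0 + siteSpin n x 1 * siteSpin n y 1)).re) /
          ((2 * k : ℕ) : ℝ) ^ 4) := by
  rintro ⟨n₀, hn₀, hall⟩
  obtain ⟨ε₀, hε₀, hmain⟩ := hall n₀ 1 le_rfl
  set n : ℕ := n₀ with hn
  have hn1 : (1 : ℝ) ≤ n := by exact_mod_cast hn₀
  have hn2 : (0 : ℝ) < 2 * (n : ℝ) ^ 2 := by positivity
  set θs : ℝ := min (ε₀ / (2 * (n : ℝ) ^ 2)) (1 / 2) with hθs_def
  have hθs0 : 0 < θs := lt_min (div_pos hε₀ hn2) (by norm_num)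
  have hθs : θs ≤ 1 / 2 := min_le_right _ _
  have hθε : θs ≤ ε₀ / (2 * (n : ℝ) ^ 2) := min_le_left _ _
  have hη : 8 * θs * ((n : ℝ) / 2) ^ 2 ≤ |ε₀| := by
    rw [abs_of_pos hε₀]
    rw [le_div_iff₀ hn2] at hθε
    nlinarith
  -- the perturbation family
  set W : ∀ L : ℕ, Op (TorusSite 2 L) (n + 1) := fun L =>
    if h : 2 ≤ L then (haveI : NeZero L := ⟨by omega⟩; ∑ x, wStar L n (XYHelix.gauge θs L) ε₀ x)
    else 0 with hW_def
  have hW : ∀ (L : ℕ) [NeZero L], 2 ≤ L → W L = ∑ x, wStar L n (XYHelix.gauge θs L) ε₀ x :=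
    fun L _ hL => dif_pos hL
  have hW' : ∀ (L : ℕ), ¬ 2 ≤ L → W L = 0 := fun L hL => dif_neg hL
  obtain ⟨k₀, hk⟩ := hmain W ε₀ (by rw [abs_of_pos hε₀]) (by
    intro L _
    by_cases hL : 2 ≤ L
    · refine ⟨wStar L n (XYHelix.gauge θs L) ε₀, hW L hL, fun x => ⟨?_, ?_, ?_, ?_⟩⟩
      · exact isSupportedOn_wStar L n _ ε₀ x
      · exact wStar_eigenvalues L n hL _ hε₀.ne' (fun y i => smallIncr_gauge L hL hθs hθs0.le y i) hη x
      · exact commute_wStar_totalSpin L n _ ε₀ x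
      · intro v
        exact reindexOp_addRight_wStar L n _
          (fun a b c => cexp_gauge_translate L (XYHelix.twistMom θs L) a b c) ε₀ x v
    · refine ⟨fun _ => 0, ?_, fun x => ?_⟩
      · rw [hW' L hL, Finset.sum_const_zero]
      · obtain ⟨h1, h2, h3⟩ := zero_rule_admissible n 1 L x
        exact ⟨h1, h2, h3, fun v => by rw [map_zero]⟩)
  -- a large even side
  obtain ⟨N, hN⟩ := exists_nat_gt (4 * Real.pi / θs)
  set k : ℕ := N + k₀ + 14 with hk_def
  have hk₀ : k₀ ≤ k := by omega
  have hk2 : 2 ≤ k := by omega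
  have hkN : (N : ℝ) ≤ k := by exact_mod_cast (by omega : N ≤ k)
  haveI : NeZero (2 * k) := ⟨by omega⟩
  have hL3 : 3 ≤ 2 * k := by omega
  have hL2 : 2 ≤ 2 * k := by omega
  set Lr : ℝ := ((2 * k : ℕ) : ℝ) with hLr
  have hLr' : Lr = 2 * (k : ℝ) := by rw [hLr]; push_cast; ring
  have hLr28 : (28 : ℝ) ≤ Lr := by rw [hLr]; exact_mod_cast (by omega : 28 ≤ 2 * k)
  have hA : 4 * Real.pi / θs ≤ Lr := by rw [hLr']; linarith
  have hpitch : θs / 2 ≤ XYHelix.pitch θs (2 * k) := XYHelix.half_le_pitch hθs0 (2 * k) hA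
  have hm : XYHelix.twistNum θs (2 * k) ≠ 0 := by
    intro h
    have : XYHelix.pitch θs (2 * k) = 0 := by rw [XYHelix.pitch, h]; simp
    linarith
  -- the conclusion of the strengthened crux on the side `2k`
  have hmain' := hk k hk₀
  rw [hW (2 * k) hL2, xyTorus_add_smul_sum_wStar (2 * k) n hL3 _ hε₀.ne'] at hmain'
  have hobs : ∀ x y : TorusSite 2 (2 * k),
      siteSpin n x 0 * siteSpin n y 0 + siteSpin n x 1 * siteSpin n y 1 = xyPair n x y :=
    fun _ _ => rfl
  simp_rw [hobs] at hmain'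
  -- the engine bound
  have hbound := twisted_order_le (2 * k) n (XYHelix.gauge θs (2 * k))
    (sum_cexpGauge_gauge_eq_zero (2 * k) hθs hθs0.le hm)
    (fun q hq => xyStructureFactor_le_of_ne_zero hn₀ hk2 hq)
  rw [← hLr] at hmain' hbound
  have hLpos : (0 : ℝ) < Lr := by linarith
  rw [le_div_iff₀ (by positivity)] at hmain'
  have key : ((n : ℝ) / 2) ^ 2 / 4 * Lr ^ 4 ≤ 8 * Lr ^ 2 * ((n : ℝ) * Lr / 5) :=
    hmain'.trans hbound
  have hnL : 28 ≤ (n : ℝ) * Lr := by nlinarith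
  have h3 : 0 ≤ (n : ℝ) * Lr ^ 3 * ((n : ℝ) * Lr - 28) :=
    mul_nonneg (by positivity) (by linarith)
  nlinarith [key, h3, pow_pos hLpos 3, hn1]


/-- **LOAD-BEARING (translation).** `XYOrderOpennessLargeSpin` with the translation covariance
clause dropped is FALSE at EVERY spin: for any `n₀`, take `n = n₀`, `r = 1`; given `ε₀`, the
star-attributed rule `w⋆_x` of the EVEN tent gauge `ψ(x) = θ_L·dist(x₀,0)`, `θ_L = 2πm/k`
(`m = ⌊kθ⋆/2π⌋`, `θ⋆ = min(ε₀/(2n²), 1/2)`), is admissible (range 1, spectrum in `[-1,1]`, `U(1)`,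
SITE-INVERSION covariant because `ψ` is even) and `H + ε₀ Σ_x w⋆_x = R_ψ H R_ψᴴ`; the tent phase
averages to zero exactly and the engine gives order parameter `≤ 8n/(5·2k) → 0`. Physically: two
domain walls of opposite helicity — a reflected spiral — invisible at momentum `0`. So any proof of
the crux must use translation covariance (together with inversion: a gauge that is both
translation covariant (linear) and inversion covariant (even) is constant). [folklore] -/
theorem xyOrderOpennessLargeSpin_false_without_translation :
    ¬ (∃ n₀ : ℕ, 1 ≤ n₀ ∧ ∀ (n r : ℕ), n₀ ≤ n → ∃ ε₀ : ℝ, 0 < ε₀ ∧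
    ∀ (W : ∀ L : ℕ, Op (TorusSite 2 L) (n + 1)) (ε : ℝ), |ε| ≤ ε₀ →
      (∀ (L : ℕ) [NeZero L], ∃ w : TorusSite 2 L → Op (TorusSite 2 L) (n + 1),
        W L = ∑ x, w x ∧ ∀ x, IsSupportedOn (w x) (torusBall x r) ∧
          (∃ hw : Matrix.IsHermitian (w x), ∀ i, |hw.eigenvalues i| ≤ 1) ∧
          Commute (w x) (totalSpin n 2) ∧
          reindexOp (Equiv.neg (TorusSite 2 L)) (w x) = w (-x)) →
      ∃ k₀ : ℕ, ∀ k : ℕ, k₀ ≤ k → ∀ [NeZero (2 * k)],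
        ((n : ℝ) / 2) ^ 2 / 4 ≤ (∑ x : TorusSite 2 (2 * k), ∑ y : TorusSite 2 (2 * k),
          ((xyTorus 2 (2 * k) n + (ε : ℂ) • W (2 * k)).groundStateFunctional
            (siteSpin n x 0 * siteSpin n y 0 + siteSpin n x 1 * siteSpin n y 1)).re) /
          ((2 * k : ℕ) : ℝ) ^ 4) := by
  rintro ⟨n₀, hn₀, hall⟩
  obtain ⟨ε₀, hε₀, hmain⟩ := hall n₀ 1 le_rfl
  set n : ℕ := n₀ with hn
  have hn1 : (1 : ℝ) ≤ n := by exact_mod_cast hn₀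
  have hn2 : (0 : ℝ) < 2 * (n : ℝ) ^ 2 := by positivity
  set θs : ℝ := min (ε₀ / (2 * (n : ℝ) ^ 2)) (1 / 2) with hθs_def
  have hθs0 : 0 < θs := lt_min (div_pos hε₀ hn2) (by norm_num)
  have hθs : θs ≤ 1 / 2 := min_le_right _ _
  have hθε : θs ≤ ε₀ / (2 * (n : ℝ) ^ 2) := min_le_left _ _
  have hη : 8 * θs * ((n : ℝ) / 2) ^ 2 ≤ |ε₀| := by
    rw [abs_of_pos hε₀]
    rw [le_div_iff₀ hn2] at hθε
    nlinarith
  -- the perturbation family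
  set W : ∀ L : ℕ, Op (TorusSite 2 L) (n + 1) := fun L =>
    if h : 2 ≤ L then (haveI : NeZero L := ⟨by omega⟩; ∑ x, wStar L n (tentGauge θs L) ε₀ x)
    else 0 with hW_def
  have hW : ∀ (L : ℕ) [NeZero L], 2 ≤ L → W L = ∑ x, wStar L n (tentGauge θs L) ε₀ x :=
    fun L _ hL => dif_pos hL
  have hW' : ∀ (L : ℕ), ¬ 2 ≤ L → W L = 0 := fun L hL => dif_neg hL
  obtain ⟨k₀, hk⟩ := hmain W ε₀ (by rw [abs_of_pos hε₀]) (by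
    intro L _
    by_cases hL : 2 ≤ L
    · refine ⟨wStar L n (tentGauge θs L) ε₀, hW L hL, fun x => ⟨?_, ?_, ?_, ?_⟩⟩
      · exact isSupportedOn_wStar L n _ ε₀ x
      · exact wStar_eigenvalues L n hL _ hε₀.ne' (fun y i => smallIncr_tentGauge L hL hθs hθs0.le y i) hη x
      · exact commute_wStar_totalSpin L n _ ε₀ x
      · exact reindexOp_neg_wStar L n _ (tentGauge_neg θs L) ε₀ x
    · refine ⟨fun _ => 0, ?_, fun x => ?_⟩
      · rw [hW' L hL, Finset.sum_const_zero]
      · obtain ⟨h1, h2, h3⟩ := zero_rule_admissible n 1 L x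
        exact ⟨h1, h2, h3, by rw [map_zero]⟩)
  -- a large even side `2k` with `1 ≤ m < k`
  obtain ⟨N, hN⟩ := exists_nat_gt (4 * Real.pi / θs)
  set k : ℕ := N + k₀ + 14 with hk_def
  have hk₀ : k₀ ≤ k := by omega
  have hk2 : 2 ≤ k := by omega
  have hk1 : 1 ≤ k := by omega
  have hkN : (N : ℝ) ≤ k := by exact_mod_cast (by omega : N ≤ k)
  haveI : NeZero (2 * k) := ⟨by omega⟩
  haveI : NeZero k := ⟨by omega⟩
  have hL3 : 3 ≤ 2 * k := by omega
  have hL2 : 2 ≤ 2 * k := by omega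
  set Lr : ℝ := ((2 * k : ℕ) : ℝ) with hLr
  have hLr' : Lr = 2 * (k : ℝ) := by rw [hLr]; push_cast; ring
  have hLr28 : (28 : ℝ) ≤ Lr := by rw [hLr]; exact_mod_cast (by omega : 28 ≤ 2 * k)
  have hA : 4 * Real.pi / θs ≤ (k : ℝ) := by linarith
  have hpitch : θs / 2 ≤ XYHelix.pitch θs k := XYHelix.half_le_pitch hθs0 k hA
  have hm0 : 0 < XYHelix.twistNum θs k := by
    rw [Nat.pos_iff_ne_zero]
    intro h
    have : XYHelix.pitch θs k = 0 := by rw [XYHelix.pitch, h]; simp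
    linarith
  have hmk : XYHelix.twistNum θs k < k := XYHelix.twistNum_lt θs hθs hθs0.le k
  -- the conclusion of the strengthened crux on the side `2k`
  have hmain' := hk k hk₀
  rw [hW (2 * k) hL2, xyTorus_add_smul_sum_wStar (2 * k) n hL3 _ hε₀.ne'] at hmain'
  have hobs : ∀ x y : TorusSite 2 (2 * k),
      siteSpin n x 0 * siteSpin n y 0 + siteSpin n x 1 * siteSpin n y 1 = xyPair n x y :=
    fun _ _ => rfl
  simp_rw [hobs] at hmain'
  -- the engine bound
  have hbound := twisted_order_le (2 * k) n (tentGauge θs (2 * k))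
    (sum_cexpGauge_tent_eq_zero hk1 hm0 hmk)
    (fun q hq => xyStructureFactor_le_of_ne_zero hn₀ hk2 hq)
  rw [← hLr] at hmain' hbound
  have hLpos : (0 : ℝ) < Lr := by linarith
  rw [le_div_iff₀ (by positivity)] at hmain'
  have key : ((n : ℝ) / 2) ^ 2 / 4 * Lr ^ 4 ≤ 8 * Lr ^ 2 * ((n : ℝ) * Lr / 5) :=
    hmain'.trans hbound
  have hnL : 28 ≤ (n : ℝ) * Lr := by nlinarith
  have h3 : 0 ≤ (n : ℝ) * Lr ^ 3 * ((n : ℝ) * Lr - 28) :=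
    mul_nonneg (by positivity) (by linarith)
  nlinarith [key, h3, pow_pos hLpos 3, hn1]



/-- **LOAD-BEARING (norm).** `XYOrderOpennessLargeSpin` with the spectral clause
`∀ i, |eigenvalues i| ≤ 1` deleted (Hermiticity kept) is FALSE at EVERY spin: on even sides the
staggered gauge `ψ = π(x₀ + x₁)` (increment `π` per bond, `u = -1`) is translation covariant and
even modulo `2π`; its star rule `w⋆_x = ε⁻¹ Σ_{b∼x} X_{x,b}` (norm `∼ 8S²/ε`, violating only the
spectral bound) satisfies `H + ε Σ_x w⋆_x = R_ψ H R_ψᴴ = -H`, the ANTIFERROMAGNETIC XY model, whose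
momentum-zero in-plane order is `≤ 8n/(5·2k) → 0` by the engine. This is the `u = -1` branch of
`cexp_incr_eq_one_of_covariant`: translation forces constant increments, inversion forces `u = ±1`,
and only the norm clause excludes `u = -1`. [folklore] -/
theorem xyOrderOpennessLargeSpin_false_without_normBound : ¬ (∃ n₀ : ℕ, 1 ≤ n₀ ∧ ∀ (n r : ℕ), n₀ ≤ n → ∃ ε₀ : ℝ, 0 < ε₀ ∧
    ∀ (W : ∀ L : ℕ, Op (TorusSite 2 L) (n + 1)) (ε : ℝ), |ε| ≤ ε₀ →
      (∀ (L : ℕ) [NeZero L], ∃ w : TorusSite 2 L → Op (TorusSite 2 L) (n + 1),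
        W L = ∑ x, w x ∧ ∀ x, IsSupportedOn (w x) (torusBall x r) ∧
          Matrix.IsHermitian (w x) ∧
          Commute (w x) (totalSpin n 2) ∧
          (∀ v, reindexOp (Equiv.addRight v) (w x) = w (x + v)) ∧
          reindexOp (Equiv.neg (TorusSite 2 L)) (w x) = w (-x)) →
      ∃ k₀ : ℕ, ∀ k : ℕ, k₀ ≤ k → ∀ [NeZero (2 * k)],
        ((n : ℝ) / 2) ^ 2 / 4 ≤ (∑ x : TorusSite 2 (2 * k), ∑ y : TorusSite 2 (2 * k),
          ((xyTorus 2 (2 * k) n + (ε : ℂ) • W (2 * k)).groundStateFunctional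
            (siteSpin n x 0 * siteSpin n y 0 + siteSpin n x 1 * siteSpin n y 1)).re) /
          ((2 * k : ℕ) : ℝ) ^ 4) := by
  rintro ⟨n₀, hn₀, hall⟩
  obtain ⟨ε₀, hε₀, hmain⟩ := hall n₀ 1 le_rfl
  set n : ℕ := n₀ with hn
  have hn1 : (1 : ℝ) ≤ n := by exact_mod_cast hn₀
  -- the perturbation family: staggered gauge on even sides `≥ 2`, zero elsewhere
  set W : ∀ L : ℕ, Op (TorusSite 2 L) (n + 1) := fun L =>
    if h : 2 ≤ L ∧ Even L then
      (haveI : NeZero L := ⟨by omega⟩; ∑ x, wStar L n (torusPhase L (halfMom L)) ε₀ x)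
    else 0 with hW_def
  have hW : ∀ (L : ℕ) [NeZero L], 2 ≤ L ∧ Even L →
      W L = ∑ x, wStar L n (torusPhase L (halfMom L)) ε₀ x := fun L _ hL => dif_pos hL
  have hW' : ∀ (L : ℕ), ¬ (2 ≤ L ∧ Even L) → W L = 0 := fun L hL => dif_neg hL
  obtain ⟨k₀, hk⟩ := hmain W ε₀ (by rw [abs_of_pos hε₀]) (by
    intro L _
    by_cases hL : 2 ≤ L ∧ Even L
    · refine ⟨wStar L n (torusPhase L (halfMom L)) ε₀, hW L hL, fun x => ⟨?_, ?_, ?_, ?_, ?_⟩⟩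
      · exact isSupportedOn_wStar L n _ ε₀ x
      · exact wStar_isHermitian L n hL.1 _ ε₀ x
      · exact commute_wStar_totalSpin L n _ ε₀ x
      · intro v
        exact reindexOp_addRight_wStar L n _
          (fun a b c => cexp_gauge_translate L (halfMom L) a b c) ε₀ x v
      · exact reindexOp_neg_wStar' L n _
          (fun a b => cexp_torusPhase_neg_of_add_self L (halfMom_add_self hL.2) a b) ε₀ x
    · refine ⟨fun _ => 0, ?_, fun x => ?_⟩
      · rw [hW' L hL, Finset.sum_const_zero]
      · obtain ⟨h1, _, h3⟩ := zero_rule_admissible n 1 L x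
        exact ⟨h1, isHermitian_zero, h3, fun v => by rw [map_zero], by rw [map_zero]⟩)
  -- a large even side
  set k : ℕ := k₀ + 14 with hk_def
  have hk₀ : k₀ ≤ k := by omega
  have hk2 : 2 ≤ k := by omega
  have hk1 : 1 ≤ k := by omega
  haveI : NeZero (2 * k) := ⟨by omega⟩
  have hL3 : 3 ≤ 2 * k := by omega
  have hLE : 2 ≤ 2 * k ∧ Even (2 * k) := ⟨by omega, even_two_mul k⟩
  set Lr : ℝ := ((2 * k : ℕ) : ℝ) with hLr
  have hLr28 : (28 : ℝ) ≤ Lr := by rw [hLr]; exact_mod_cast (by omega : 28 ≤ 2 * k)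
  have hmain' := hk k hk₀
  rw [hW (2 * k) hLE, xyTorus_add_smul_sum_wStar (2 * k) n hL3 _ hε₀.ne'] at hmain'
  have hobs : ∀ x y : TorusSite 2 (2 * k),
      siteSpin n x 0 * siteSpin n y 0 + siteSpin n x 1 * siteSpin n y 1 = xyPair n x y :=
    fun _ _ => rfl
  simp_rw [hobs] at hmain'
  have hbound := twisted_order_le (2 * k) n (torusPhase (2 * k) (halfMom (2 * k)))
    (sum_cexpGauge_torusPhase_eq_zero (2 * k) (halfMom_ne_zero hk1))
    (fun q hq => xyStructureFactor_le_of_ne_zero hn₀ hk2 hq)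
  rw [← hLr] at hmain' hbound
  have hLpos : (0 : ℝ) < Lr := by linarith
  rw [le_div_iff₀ (by positivity)] at hmain'
  have key : ((n : ℝ) / 2) ^ 2 / 4 * Lr ^ 4 ≤ 8 * Lr ^ 2 * ((n : ℝ) * Lr / 5) :=
    hmain'.trans hbound
  have hnL : 28 ≤ (n : ℝ) * Lr := by nlinarith
  have h3 : 0 ≤ (n : ℝ) * Lr ^ 3 * ((n : ℝ) * Lr - 28) :=
    mul_nonneg (by positivity) (by linarith)
  nlinarith [key, h3, pow_pos hLpos 3, hn1]


end Summit.HubbardSuperconductivity.HubbardSuperconductivity.Theorems.XYOrderOpennessLargeSpin.Negative
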